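import Summits.QuantumFields.YangMills.Theorems.UV3UnitEnvelopeOrganOfMassEnvelopeV3
import Summits.QuantumFields.YangMills.Theorems.UV3BranchExpansionHTopT3EveryLevel
import HarnessLib

/-!
# `UV3ACLargeFieldEnvelopeAtLevel` — R3 (cell `ym3-torus`, YM₃ on T³ — a ladder RUNG, NOT d = 4, NOT infinite volume, NOT a mass gap, NOT the Clay problem):
# **THE (41)_k LARGE-FIELD HISTORY SUM OF THE PINNED `blockAvg ℰp` TOWER IS K-UNIFORMLY ESSENTIALLY BOUNDED AT EVERY LEVEL `k ≤ K`**, modulo the v3 (α) package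

Width seat `ym3-torus-px8` g15 (★★OWNER WORD 102 «GO (O-UP)»; LOCATE `LOCATE-END-THM1-TO-BOUNDS5-px8g15.md`, 20520 evidence #59).  THEOREMS ONLY (0 `def`, 0 `sorry`,
default heartbeats); `--supports stmt-QuantumFields-20520 --as helper`; count-neutral.  CONDITIONAL on the v3 (α) package `AlphaInputsT3AC.PkgAtV3 F 𝔠 γ hγ hγ1 K`
(the ∃-clause of the socket of record `AlphaInputsT3AC.OfV3At` ∕ `AlphaInputsT3ACv3Rec`, OPEN); nothing of [Balaban1985UV3] is asserted.

WHY (the ⟨UP⟩ road of the 20520 persistence organ, LOCATE §0 item 4 as corrected on the bus 08:49Z).  [Balaban1985UV3] Theorem 1's UPPER bound (5) at step `k` is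
(41)_k (Theorem 2) + the resummation of pp.273–274 («The analysis of Sect. 3.C [9], which is model independent, show that these small factors are enough to control all
sums in (41)»).  Print's masses are `≤ 1` by the exact Haar compatibility of its averaging; the tree's `blockAvg ℰp` is only absolutely continuous, so the resummation must
run UNDER A MASS ENVELOPE — the 19936 lane did exactly this AT THE UNIT LATTICE `k = K` (✓`UV3UnitEnvelopeOrganOfMassEnvelopeV3.all_le_of_massEnvelope_v3` over
✓`UV3LargeFieldEnvelopedResummation.largeField_enveloped_adm`, the envelope from hTop via ✓`UV3StartClosedOfTopHaarPushforward`).  The heightwise bound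
`Bounds5UpperAtHeight` (lit `T3HeightwiseDensityBounds`) needs the SAME at EVERY level `k = K − n`.  THIS FILE supplies the level-`k` twins:
* §1 `Zterm_towerOfAC_le_booked` — the booked Z-terms against the counted collars at every level `k ≤ K` (twin of ✓`Zterm_towerOfAC_top_le_booked`; (39)∕(41) p.266).
* (the mass envelope at every level is px20 g12's ✓`UV3BranchExpansionHTopT3EveryLevel.massP_le_exp_ae_of_level` — ONE `A ≥ 0` per family with the PINNED masses
  `PinnedStep.massP 𝔠.lane p.X k r` (= `MassesPAC.massRecP` along `avT3 F K`, trivial history ≡ 1, no floor) `≤ exp(#PBond(F.P K) k·A)` `dU_k`-a.e. at EVERY level; from the hTop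
  segment letters of the three block-size ranges via px8 g10's ✓`massRecP_le_exp_ae_of_map_iterFrom_le_top` — IMPORTED, not retyped.)
* §2 ★★★ `all_le_of_massEnvelope_v3_at` — the enveloped resummation at level `k ≤ K` (✓`largeField_enveloped_adm` (U) with the v3 rows' small factors
  ✓`smallFactorsAdm_towerOfAC_v3`, §1, the counted collars ✓`zvol_real_le_sum`, the provisos `prov_hp`∕`prov_hb₁`∕`prov_hb₂`), ★★★ `lfSum_le_exp_ae_of_massEnvelope` (the a.e. form under any level-`k` mass envelope) and ★★★ `exists_lfSum_le_exp_ae` — for every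
  `k ≤ K`, `dU_k`-a.e. in `W`: `Σ_r wtP_k(r, W)·exp(−mainT_k(r, W) + Zterm_k(r)) ≤ exp(#PBond(F.P K) k·A)·exp((3∕(½ log L))·#Site(F.P K, k))` — K enters ONLY through the
  level-`k` lattice counts, which at `k = K − n` are the height-`n` counts (`(2L^{m+n})³` sites).
HONEST SCOPE.  Bookkeeping over landed theorems; conditional on the v3 package; nothing of (5)∕(41)∕(47), ⟨UP⟩, PERS₁∘, 20520, 19936, the rung, d = 4, a mass gap or Clay is
proved here; the Yang–Mills mass gap is NOT proved.

References: T. Bałaban, Commun. Math. Phys. **102** (1985) 255–275 [Balaban1985UV3] ((2) p.256, (5) p.256, (39)–(41) p.266, (48) p.268, (67)–(71) p.273, pp.273–274);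
T. Bałaban, Commun. Math. Phys. **109** (1987) 249–301 [Balaban1987RG1] ((0.4), (0.11) p.253).
-/

set_option autoImplicit false

noncomputable section

namespace Summit.QuantumFields.YangMills.Theorems.UV3ACLargeFieldEnvelopeAtLevel

open MeasureTheory
open scoped BigOperators ENNReal
open Literature.MathematicalPhysics.QuantumFieldTheory.Balaban1983to89
open Literature.MathematicalPhysics.QuantumFieldTheory.Balaban1983to89.B10LargeField (xlog one_le_xlog xlog_gRun)
open Literature.MathematicalPhysics.QuantumFieldTheory.Balaban1983to89.T3ContinuumYM3Torus
open Literature.MathematicalPhysics.QuantumFieldTheory.Balaban1983to89.T3UnitLawDensityEML (ℰp)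
open Literature.MathematicalPhysics.QuantumFieldTheory.Balaban1985CMP102
open Literature.MathematicalPhysics.QuantumFieldTheory.Balaban1985CMP102.Setting
open Summit.QuantumFields.Balaban3D.Carriers
open Summit.QuantumFields.Balaban3D.Proofs.Primitives
open Summit.QuantumFields.Balaban3D.Proofs.ScalesArithmetic (gk_pos gk_le_one g0sq_pos gk_eq_gRun_norm)
open Summit.QuantumFields.Balaban3D.Proofs.GroupModelLieC (lieC)
open Summit.QuantumFields.Balaban3D.Proofs.Family (prov_hb₁ prov_hb₂ prov_hp)
open Summit.QuantumFields.Balaban3D.Proofs.TowerAC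
open Summit.QuantumFields.Balaban3D.Proofs.StandardAC
open Summit.QuantumFields.Balaban3D.Proofs.InputsAC
open Summit.QuantumFields.Balaban3D.Proofs.HistCount (card_filter_allCodes_le_exp)
open Summit.QuantumFields.Balaban3D.Proofs.LargeFieldStd (rcolOf_antitone rcolOf_le zcoefOf_le zcoefOf_nonneg)
open Summit.QuantumFields.YangMills.Theorems.UV3LargeFieldEnvelopedResummation (largeField_enveloped_adm)
open Summit.QuantumFields.YangMills.Theorems.UV3PinnedCollarBranch (zvol_real_le_sum)
open Summit.QuantumFields.YangMills.Theorems.UV3UnitEnvelopeOrganOfMassEnvelopeV3 (smallFactorsAdm_towerOfAC_v3)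
open Summit.QuantumFields.YangMills.Theorems.UV3BranchExpansionHTopT3EveryLevel (massP_le_exp_ae_of_level)

variable {F : T3Family} {𝔠 : AlphaConsts F.L (suGroupModel 2).N} {γ : ℝ} {hγ : 0 < γ} {hγ1 : γ ≤ (min 𝔠.gamma0 1) ^ 2} {K : ℕ}

/-! ## §1 The booked Z-terms against the counted collars, every level -/

/-- **`Zterm_k(r) ≤ Σ_{i<k} A·x(g_i)·zvol_i(P(r))`** at EVERY level `k ≤ K`, for ANY AC inputs `X, 𝔖` at the T³ scales (level-`k` twin of
✓`UV3UnitEnvelopeOrganOfMassEnvelopeV3.Zterm_towerOfAC_top_le_booked`): the tower's booked Z-terms `Σ_{i<k} CZ_i·|Z_i(r)|` (`towerOfAC`, by `rfl`) with `CZ_i ≤ A·x(g_i)`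
(`LargeFieldStd.zcoefOf_le`, `A = (Cz+Cv)+C₅+C₆+(|logσ₀|+dg)c₁`) and the collar count `|Z_i(r)| ≤ Σ_{(i′,p′)∈P(r), i′≤i} (K_c·x(g_{i′})^{r₀})³` (✓`zvol_real_le_sum`).
[cite: Balaban1985UV3, (39) p.266, (41) p.266] -/
theorem Zterm_towerOfAC_le_booked
    (X : ExternalInputsAC (T3Scales F γ hγ (hγ1.trans (sq_min_one_le _ 𝔠.gamma0_pos)) K) (Matrix.specialUnitaryGroup (Fin 2) ℂ))
    (𝔖 : ∀ k, StepSeries (T3Scales F γ hγ (hγ1.trans (sq_min_one_le _ 𝔠.gamma0_pos)) K) (Matrix.specialUnitaryGroup (Fin 2) ℂ)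
      ↥(lieC (suGroupModel 2)) (nblkOf (T3Scales F γ hγ (hγ1.trans (sq_min_one_le _ 𝔠.gamma0_pos)) K) 𝔠.lane.carrier k) k)
    (k : ℕ) (hk : k ≤ K) (r : Hist (F.P K) k) :
    (towerOfAC 𝔠.lane X 𝔖).Zterm k r ≤ ∑ i ∈ Finset.range k,
      ((𝔠.lane.carrier.Cz + 𝔠.lane.carrier.Cv) + 𝔠.lane.carrier.C₅ + 𝔠.lane.carrier.C₆ +
          (|𝔠.lane.carrier.logσ₀| + 𝔠.lane.carrier.dg) * 𝔠.lane.carrier.c₁) *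
        xlog ((T3Scales F γ hγ (hγ1.trans (sq_min_one_le _ 𝔠.gamma0_pos)) K).gk i) *
        ∑ e ∈ (Hist.disc r).filter (fun e => e.1 ≤ i),
          (2 * (2 * ((𝔠.lane.carrier.R₁ + 1) * 𝔠.lane.carrier.M₁) + 2 * ((F.L : ℝ) * (3 * ((𝔠.lane.carrier.M₁ : ℝ) - 1)) + 3 * ((F.L : ℝ) - 1)) + 20) * 1) ^ 3 *
            xlog ((T3Scales F γ hγ (hγ1.trans (sq_min_one_le _ 𝔠.gamma0_pos)) K).gk e.1) ^ (3 * 𝔠.lane.carrier.r₀) := by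
  have hSK : (T3Scales F γ hγ (hγ1.trans (sq_min_one_le _ 𝔠.gamma0_pos)) K).K = K := rfl
  have hL : 2 ≤ F.L := F.hL.2
  have hR₁ : 0 ≤ 𝔠.lane.carrier.R₁ := 𝔠.R₁_nonneg
  have hr : 0 ≤ 𝔠.lane.carrier.r₀ := le_trans zero_le_one 𝔠.one_le_r₀
  have hM : 0 < 𝔠.lane.carrier.M₁ := 𝔠.lane.F.M₁_pos
  have hCz : 0 ≤ 𝔠.lane.carrier.Cz + 𝔠.lane.carrier.Cv := add_nonneg 𝔠.Cz_nonneg 𝔠.Cv_nonneg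
  have h5 : 0 ≤ 𝔠.lane.carrier.C₅ := 𝔠.C₅_nonneg
  have h6 : 0 ≤ 𝔠.lane.carrier.C₆ := 𝔠.C₆_nonneg
  have hc₁ : 0 ≤ 𝔠.lane.carrier.c₁ := by show (0 : ℝ) ≤ 3; norm_num
  have hg : ∀ i, i ≤ (T3Scales F γ hγ (hγ1.trans (sq_min_one_le _ 𝔠.gamma0_pos)) K).K → 0 < (T3Scales F γ hγ (hγ1.trans (sq_min_one_le _ 𝔠.gamma0_pos)) K).gk i ∧ (T3Scales F γ hγ (hγ1.trans (sq_min_one_le _ 𝔠.gamma0_pos)) K).gk i ≤ 1 := fun i hi => ⟨gk_pos (T3Scales F γ hγ (hγ1.trans (sq_min_one_le _ 𝔠.gamma0_pos)) K) i, gk_le_one (T3Scales F γ hγ (hγ1.trans (sq_min_one_le _ 𝔠.gamma0_pos)) K) (T3Scales F γ hγ (hγ1.trans (sq_min_one_le _ 𝔠.gamma0_pos)) K).gK_le_one i hi⟩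
  have hkS : k ≤ (T3Scales F γ hγ (hγ1.trans (sq_min_one_le _ 𝔠.gamma0_pos)) K).K := by rw [hSK]; exact hk
  have hZ : (towerOfAC 𝔠.lane X 𝔖).Zterm k r = ∑ i ∈ Finset.range k,
      zcoefOf (T3Scales F γ hγ (hγ1.trans (sq_min_one_le _ 𝔠.gamma0_pos)) K) 𝔠.lane.carrier i * (ZVol 𝔠.lane.carrier.M₁ (rcolOf (T3Scales F γ hγ (hγ1.trans (sq_min_one_le _ 𝔠.gamma0_pos)) K) 𝔠.lane.carrier) k r i : ℝ) := rfl
  rw [hZ]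
  refine Finset.sum_le_sum fun i hi => ?_
  rw [Finset.mem_range] at hi
  have hiK : i < (T3Scales F γ hγ (hγ1.trans (sq_min_one_le _ 𝔠.gamma0_pos)) K).K := lt_of_lt_of_le hi hkS
  have hz := zcoefOf_le (S := (T3Scales F γ hγ (hγ1.trans (sq_min_one_le _ 𝔠.gamma0_pos)) K)) 𝔠.lane.carrier hCz h5 h6 hc₁ i hiK
  have hz0 := zcoefOf_nonneg (S := (T3Scales F γ hγ (hγ1.trans (sq_min_one_le _ 𝔠.gamma0_pos)) K)) 𝔠.lane.carrier hCz h5 h6 hc₁ i hiK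
  have hcol := zvol_real_le_sum (S := (T3Scales F γ hγ (hγ1.trans (sq_min_one_le _ 𝔠.gamma0_pos)) K)) 𝔠.lane.carrier.M₁ (rcolOf (T3Scales F γ hγ (hγ1.trans (sq_min_one_le _ 𝔠.gamma0_pos)) K) 𝔠.lane.carrier) hM (rcolOf_antitone (S := (T3Scales F γ hγ (hγ1.trans (sq_min_one_le _ 𝔠.gamma0_pos)) K)) 𝔠.lane.carrier hR₁ hr)
    hL (ρ' := (𝔠.lane.carrier.R₁ + 1) * 𝔠.lane.carrier.M₁) (by positivity) hr (rcolOf_le (S := (T3Scales F γ hγ (hγ1.trans (sq_min_one_le _ 𝔠.gamma0_pos)) K)) 𝔠.lane.carrier hR₁ hr) hg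
    k hkS r i hi
  have hV0 : (0 : ℝ) ≤ (ZVol 𝔠.lane.carrier.M₁ (rcolOf (T3Scales F γ hγ (hγ1.trans (sq_min_one_le _ 𝔠.gamma0_pos)) K) 𝔠.lane.carrier) k r i : ℝ) := Nat.cast_nonneg _
  calc zcoefOf (T3Scales F γ hγ (hγ1.trans (sq_min_one_le _ 𝔠.gamma0_pos)) K) 𝔠.lane.carrier i * (ZVol 𝔠.lane.carrier.M₁ (rcolOf (T3Scales F γ hγ (hγ1.trans (sq_min_one_le _ 𝔠.gamma0_pos)) K) 𝔠.lane.carrier) k r i : ℝ)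
      ≤ (((𝔠.lane.carrier.Cz + 𝔠.lane.carrier.Cv) + 𝔠.lane.carrier.C₅ + 𝔠.lane.carrier.C₆ +
          (|𝔠.lane.carrier.logσ₀| + 𝔠.lane.carrier.dg) * 𝔠.lane.carrier.c₁) * xlog ((T3Scales F γ hγ (hγ1.trans (sq_min_one_le _ 𝔠.gamma0_pos)) K).gk i)) *
          (ZVol 𝔠.lane.carrier.M₁ (rcolOf (T3Scales F γ hγ (hγ1.trans (sq_min_one_le _ 𝔠.gamma0_pos)) K) 𝔠.lane.carrier) k r i : ℝ) := mul_le_mul_of_nonneg_right hz hV0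
    _ ≤ _ := mul_le_mul_of_nonneg_left hcol (hz0.trans hz)

/-! ## §2 The enveloped resummation at every level, and the a.e. bound of the (41)_k history sum -/

/-- ★★★ **THE UN-PINNED (41)_k HISTORY SUM UNDER A MASS ENVELOPE ON ALL ADMISSIBLE HISTORIES, EVERY LEVEL `k ≤ K`** (level-`k` twin of
✓`all_le_of_massEnvelope_v3`): ✓`largeField_enveloped_adm` (U) at the v3 package with `H := univ`, the windowed pinned weights `wtP_k`, the v3 rows' admissible small factors
(✓`smallFactorsAdm_towerOfAC_v3`, every `k`), §1, the counted collars (✓`zvol_real_le_sum`), the provisos (`prov_hp`∕`prov_hb₁`∕`prov_hb₂`): for a field `W` with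
`wtP_k(r, W) ≤ e^{A}` on admissible `r`, `Σ_r wtP_k(r,W)·e^{−mainT_k(r,W) + Zterm_k(r)} ≤ e^{A}·exp((3∕(½ log L))·#Site(F.P K, k))`. [cite: Balaban1985UV3, (41) p.266, (67)–(71) p.273, pp.273–274] -/
theorem all_le_of_massEnvelope_v3_at (p : AlphaInputsT3AC.PkgAtV3 F 𝔠 γ hγ hγ1 K) (k : ℕ) (hk : k ≤ K) {A : ℝ}
    (W : GaugeField (F.P K) k (Matrix.specialUnitaryGroup (Fin 2) ℂ))
    (hW : ∀ r : Hist (F.P K) k,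
      Hist.Admissible 𝔠.lane.carrier.M₁ (rcolOf (T3Scales F γ hγ (hγ1.trans (sq_min_one_le _ 𝔠.gamma0_pos)) K) 𝔠.lane.carrier) k r →
      p.wtP k r W ≤ Real.exp A) :
    ∑ r : Hist (F.P K) k, p.wtP k r W * Real.exp (-(p.T.mainT k r W) + p.T.Zterm k r)
      ≤ Real.exp A * Real.exp (3 / (Real.log F.L / 2) * (Fintype.card (Site (F.P K) k) : ℝ)) := by
  classical
  set S := T3Scales F γ hγ (hγ1.trans (sq_min_one_le _ 𝔠.gamma0_pos)) K with hS
  have hSK : S.K = K := rfl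
  have hL : 2 ≤ F.L := F.hL.2
  have hLr : (2 : ℝ) ≤ F.L := by exact_mod_cast hL
  have hR₁ : 0 ≤ 𝔠.lane.carrier.R₁ := 𝔠.R₁_nonneg
  have hr : 0 ≤ 𝔠.lane.carrier.r₀ := le_trans zero_le_one 𝔠.one_le_r₀
  have hM : 0 < 𝔠.lane.carrier.M₁ := 𝔠.lane.F.M₁_pos
  have hNpos : 0 < (suGroupModel 2).N := (suGroupModel 2).N_pos
  have hg : ∀ i, i ≤ K → 0 < S.gk i ∧ S.gk i ≤ 1 := fun i hi => ⟨gk_pos S i, gk_le_one S S.gK_le_one i hi⟩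
  have hlogL : 0 < Real.log F.L := Real.log_pos (by linarith)
  have hℓ : 0 < Real.log (F.L : ℝ) / 2 := by positivity
  -- the progression of the couplings
  have hx : ∀ i, i ≤ K → xlog (S.gk i) = xlog (S.gk K) + ((K - i : ℕ) : ℝ) * (Real.log F.L / 2) := by
    intro i hi
    rw [gk_eq_gRun_norm S i, gk_eq_gRun_norm S K]
    exact xlog_gRun 1 (F.L : ℝ) S.g0sq one_pos (by linarith) (g0sq_pos S) hi
  -- the sign of `A` and the provisos
  have hAz : 0 ≤ (𝔠.lane.carrier.Cz + 𝔠.lane.carrier.Cv) + 𝔠.lane.carrier.C₅ + 𝔠.lane.carrier.C₆ +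
      (|𝔠.lane.carrier.logσ₀| + 𝔠.lane.carrier.dg) * 𝔠.lane.carrier.c₁ := by
    have := 𝔠.lane.carrier.dg_nonneg
    have := abs_nonneg 𝔠.lane.carrier.logσ₀
    have hCz : 0 ≤ 𝔠.lane.carrier.Cz + 𝔠.lane.carrier.Cv := add_nonneg 𝔠.Cz_nonneg 𝔠.Cv_nonneg
    have h5 : 0 ≤ 𝔠.lane.carrier.C₅ := 𝔠.C₅_nonneg
    have h6 : 0 ≤ 𝔠.lane.carrier.C₆ := 𝔠.C₆_nonneg
    have hc₁ : 0 ≤ 𝔠.lane.carrier.c₁ := by show (0 : ℝ) ≤ 3; norm_num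
    positivity
  have hp := prov_hp 𝔠
  have hb₁ := prov_hb₁ 𝔠 hNpos
  have hb₂ := prov_hb₂ 𝔠 hNpos
  have hcL : 𝔠.lane.consts.L = (F.L : ℝ) := rfl
  rw [hcL] at hb₁
  have hMr : (1 : ℝ) ≤ 𝔠.lane.carrier.M₁ := by exact_mod_cast hM
  have hcg : (0 : ℝ) ≤ (2 * (2 * ((𝔠.lane.carrier.R₁ + 1) * 𝔠.lane.carrier.M₁) +
      2 * ((F.L : ℝ) * (3 * ((𝔠.lane.carrier.M₁ : ℝ) - 1)) + 3 * ((F.L : ℝ) - 1)) + 20)) * 1 := by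
    have h1 : (0 : ℝ) ≤ (𝔠.lane.carrier.R₁ + 1) * 𝔠.lane.carrier.M₁ := by positivity
    have h2 : (0 : ℝ) ≤ (F.L : ℝ) * (3 * ((𝔠.lane.carrier.M₁ : ℝ) - 1)) := by nlinarith
    nlinarith
  refine (largeField_enveloped_adm (k := k) (K := K) hk S.gk (b₀ := 𝔠.lane.carrier.b₀) (p₀ := 𝔠.lane.carrier.p₀)
    (A := (𝔠.lane.carrier.Cz + 𝔠.lane.carrier.Cv) + 𝔠.lane.carrier.C₅ + 𝔠.lane.carrier.C₆ +
      (|𝔠.lane.carrier.logσ₀| + 𝔠.lane.carrier.dg) * 𝔠.lane.carrier.c₁) (A₀ := 0)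
    (c₁ := 1 / (4 * ((suGroupModel 2).N : ℝ))) (gs := 1)
    (cg := 2 * (2 * ((𝔠.lane.carrier.R₁ + 1) * 𝔠.lane.carrier.M₁) + 2 * ((F.L : ℝ) * (3 * ((𝔠.lane.carrier.M₁ : ℝ) - 1)) + 3 * ((F.L : ℝ) - 1)) + 20))
    (ρ := 1) (r₀ := 𝔠.lane.carrier.r₀) (ℓ := Real.log F.L / 2) (xK := xlog (S.gk K)) (S := (Fintype.card (Site (F.P K) k) : ℝ))
    (σ := 3 * Real.log F.L) (Menv := Real.exp A)
    (allCodes (F.P K) k) (fun e he => Hist.disc_lt _ e he) ?cardE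
    (Finset.univ : Finset (Hist (F.P K) k))
    (Hist.Admissible 𝔠.lane.carrier.M₁ (rcolOf S 𝔠.lane.carrier) k) Hist.disc
    (fun r _ _ => Hist.disc_subset_allCodes r) ((Hist.disc_injective k).injOn.mono (Set.subset_univ _))
    (fun r => p.wtP k r W) (fun r => p.T.mainT k r W) (fun r => p.T.Zterm k r)
    (fun i Q => ∑ e ∈ Q.filter (fun e => e.1 ≤ i),
      (2 * (2 * ((𝔠.lane.carrier.R₁ + 1) * 𝔠.lane.carrier.M₁) + 2 * ((F.L : ℝ) * (3 * ((𝔠.lane.carrier.M₁ : ℝ) - 1)) + 3 * ((F.L : ℝ) - 1)) + 20) * 1) ^ 3 *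
        xlog (S.gk e.1) ^ (3 * 𝔠.lane.carrier.r₀))
    (Real.exp_pos _).le ?madm ?menv ?sf ?zt (fun Q _ i _ => le_rfl)
    hAz le_rfl (by positivity) hcg hr hℓ (Nat.cast_nonneg _) hg le_rfl hx hp ?b1 ?b2).1
  case cardE =>
    intro i hi
    have hPL : (F.P K).L = F.L := rfl
    have h := card_filter_allCodes_le_exp (P := F.P K) rfl hi (by show k ≤ F.m + K; omega)
    rw [hPL] at h
    exact h
  case madm =>
    intro r _ hna
    exact PinnedStep.wtP_eq_zero_of_not_admissible 𝔠.lane p.X (AlphaInputsT3AC.admWindowT3 F 𝔠 γ hγ hγ1 K) k r W hna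
  case menv =>
    intro r _ hadm
    rw [zero_mul, Real.exp_zero, mul_one]
    exact hW r hadm
  case sf =>
    intro r _ hadm
    exact smallFactorsAdm_towerOfAC_v3 (T3Scales_window F 𝔠 γ hγ hγ1 K) hL p.run k hk W r hadm
  case zt =>
    intro r _ _
    exact Zterm_towerOfAC_le_booked (hγ1 := hγ1) p.X p.𝔖 k hk r
  case b1 =>
    simpa using hb₁
  case b2 =>
    nlinarith [hb₂, hlogL]

/-- ★★★ **THE (41)_k LARGE-FIELD HISTORY SUM UNDER ANY LEVEL-`k` a.e. MASS ENVELOPE**: if every pinned mass `massP_k(r, ·)` is `≤ e^{M}` almost everywhere (finitely many histories,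
gathered by `ae_all_iff`), then `dU_k^{(K)}`-almost every `W` has `Σ_r wtP_k(r, W)·exp(−mainT_k(r, W) + Zterm_k(r)) ≤ e^{M}·exp((3∕(½ log L))·#Site(F.P K, k))` (`wtP ≤ massP`,
`PinnedStep.wtP_nonneg_le`; then §2). [cite: Balaban1985UV3, (5) p.256, (41) p.266, (67)–(71) p.273, pp.273–274] -/
theorem lfSum_le_exp_ae_of_massEnvelope (p : AlphaInputsT3AC.PkgAtV3 F 𝔠 γ hγ hγ1 K) (k : ℕ) (hk : k ≤ K) {M : ℝ}
    (hmass : ∀ r : Hist (F.P K) k, ∀ᵐ W ∂fieldMeasure (F.P K) k (Matrix.specialUnitaryGroup (Fin 2) ℂ),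
      PinnedStep.massP 𝔠.lane p.X k r W ≤ Real.exp M) :
    ∀ᵐ W ∂fieldMeasure (F.P K) k (Matrix.specialUnitaryGroup (Fin 2) ℂ),
      ∑ r : Hist (F.P K) k, p.wtP k r W * Real.exp (-(p.T.mainT k r W) + p.T.Zterm k r)
        ≤ Real.exp M * Real.exp (3 / (Real.log F.L / 2) * (Fintype.card (Site (F.P K) k) : ℝ)) := by
  have hae : ∀ᵐ W ∂(fieldMeasure (F.P K) k (Matrix.specialUnitaryGroup (Fin 2) ℂ)), ∀ r : Hist (F.P K) k,
      PinnedStep.massP 𝔠.lane p.X k r W ≤ Real.exp M := ae_all_iff.2 hmass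
  filter_upwards [hae] with W hW
  refine all_le_of_massEnvelope_v3_at p k hk W fun r _ => ?_
  exact (PinnedStep.wtP_nonneg_le 𝔠.lane p.X (AlphaInputsT3AC.admWindowT3 F 𝔠 γ hγ hγ1 K) k r W).2.trans (hW r)

/-- ★★★ **THE (41)_k LARGE-FIELD HISTORY SUM OF THE PINNED `blockAvg ℰp` TOWER IS K-UNIFORMLY ESSENTIALLY BOUNDED AT EVERY LEVEL, CONDITIONAL ON THE v3 PACKAGE ONLY** —
the row `hlf` of Theorem 1's upper bound at every `k ≤ K`, NO displayed letter: for every three-torus family there is `A ≥ 0` (px20 g12's ✓`massP_le_exp_ae_of_level`, the hTop mass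
envelope at every level) such that for every v3 package at any `(γ, K)` and every `k ≤ K`, `dU_k^{(K)}`-almost every `W` has
`Σ_r wtP_k(r, W)·exp(−mainT_k(r, W) + Zterm_k(r)) ≤ exp(#PBond(F.P K) k·A + (3∕(½ log L))·#Site(F.P K, k))` — at `k = K − n` both counts are the height-`n` counts, K-FREE.
[cite: Balaban1985UV3, (5) p.256, (41) p.266, pp.273–274] -/
theorem exists_lfSum_le_exp_ae (F : T3Family) :
    ∃ A : ℝ, 0 ≤ A ∧ ∀ (𝔠 : AlphaConsts F.L (suGroupModel 2).N) (γ : ℝ) (hγ : 0 < γ) (hγ1 : γ ≤ (min 𝔠.gamma0 1) ^ 2) (K : ℕ)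
      (p : AlphaInputsT3AC.PkgAtV3 F 𝔠 γ hγ hγ1 K) (k : ℕ), k ≤ K →
      ∀ᵐ W ∂fieldMeasure (F.P K) k (Matrix.specialUnitaryGroup (Fin 2) ℂ),
        ∑ r : Hist (F.P K) k, p.wtP k r W * Real.exp (-(p.T.mainT k r W) + p.T.Zterm k r)
          ≤ Real.exp ((Fintype.card (PBond (F.P K) k) : ℝ) * A + 3 / (Real.log F.L / 2) * (Fintype.card (Site (F.P K) k) : ℝ)) := by
  obtain ⟨A, hA, hmass⟩ := massP_le_exp_ae_of_level F
  refine ⟨A, hA, fun 𝔠 γ hγ hγ1 K p k hk => ?_⟩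
  filter_upwards [lfSum_le_exp_ae_of_massEnvelope p k hk (fun r => hmass 𝔠 γ hγ hγ1 K p k (by omega) r)] with W hW
  rw [Real.exp_add]
  exact hW

end Summit.QuantumFields.YangMills.Theorems.UV3ACLargeFieldEnvelopeAtLevel

end
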